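import Literature.Analysis.FluidPDE.LocalTypeIReverse
import HarnessLib

/-!
# Albritton–Barker 2019, Theorem 1.1 from its printed tools

Trunk T-FLUID (`Literature/Analysis/FluidPDE`); companion of
`Literature/Analysis/FluidPDE/LocalTypeI.lean` (Albritton–Barker 2019, Thm 1.1, corrected
rendering `Literature.Analysis.FluidPDE.AlbrittonBarkerTypeICharacterization :=
LocalTypeISingularityExists ↔ NontrivialMildAncientTypeIExists`).

The reverse implication of Theorem 1.1 — the paper's novelty — is proved in
`LocalTypeIReverse.lean` from the two tools the paper states and quotes, Lemma 2.2
(`SuitableCompactness`) and Prop. 2.3 (`PersistenceOfSingularities`). The forward implication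
("essentially known", A–B §3) is quoted in the paper from the literature: by Prop. 2.4 (regular
cylinder lemma, after Kukavica–Rusin–Ziane 2017 and Seregin–Šverák's handbook article) one
passes to an earlier singular point `z*` with `v ∈ L^∞(Q(z*, R) \ Q(z*, r))` for all `r`, and the
rescaling procedure of Seregin–Šverák 2009 (§2, assumptions (b8)–(b10), Thm 2.8: the rescaled
`u^k(y, s) = λ_k v(x^k + λ_k y, t_k + λ_k² s)`, `λ_k = 1/M_k`, converge locally uniformly to a
mild bounded ancient solution `u` with `|u(0, 0)| = 1`) produces the ancient solution, which
inherits `𝐈 < ∞` from the scale-invariant bound around the rescaling centres (this is where the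
all-balls Type I notion `𝐈(Q') < ∞` is used). This file vendors that forward implication as the
named fact `AlbrittonBarkerForward` and assembles

* `albrittonBarkerTypeICharacterization_of_tools :
    AlbrittonBarkerForward → SuitableCompactness → PersistenceOfSingularities →
    AlbrittonBarkerTypeICharacterization`.

So the trust base of the corrected Theorem 1.1 is reduced to three printed results: the
forward half (Seregin–Šverák's blow-up procedure), Lin's compactness lemma and Rusin–Šverák's
persistence of singularities (the latter two resting on the Caffarelli–Kohn–Nirenberg
ε-regularity theory).

## References

* D. Albritton, T. Barker, *On local Type I singularities of the Navier–Stokes equations and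
  Liouville theorems*, J. Math. Fluid Mech. 21 (2019), arXiv:1811.00502, Thm 1.1, Prop. 2.4,
  §3 (proof of Thm 1.1, forward direction).
* G. Seregin, V. Šverák, *On Type I singularities of the local axi-symmetric solutions of the
  Navier–Stokes equations*, Comm. PDE 34 (2009), 171–201, arXiv:0804.1803, §2, Thm 2.8.
* I. Kukavica, W. Rusin, M. Ziane, *On local regularity conditions for the Navier–Stokes
  equations*, J. Math. Fluid Mech. (2017) (A–B's reference for Prop. 2.4).
-/

noncomputable section

namespace Literature.Analysis.FluidPDE

/-- **Albritton–Barker 2019, Theorem 1.1, forward direction** (first bullet ⇒ second bullet):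
if there is a suitable weak solution with a Type I singular point — `(u, p)` suitable in a
parabolic ball `Q(z, r₀)` whose centre is a backward singular point, with
`𝐈(Q(z, r₀)) = sup_{Q' ⊆ Q(z, r₀)} (A + C + D + E)(Q') < ∞` (`LocalTypeISingularityExists`) —
then there is a non-trivial mild bounded ancient solution with `𝐈 < ∞`
(`NontrivialMildAncientTypeIExists`). Printed proof (A–B §3): Prop. 2.4 (regular cylinder
lemma) and the Seregin–Šverák rescaling procedure (Seregin–Šverák 2009, §2, Thm 2.8), the
bound `𝐈 < ∞` being "clear from the rescaling procedure". Vendored as a named fact; the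
reverse direction is the theorem
`localTypeISingularityExists_of_nontrivialMildAncientTypeIExists`.
[cite: AlbrittonBarker2019, Thm 1.1 (forward direction), §3] -/
def AlbrittonBarkerForward : Prop :=
  LocalTypeISingularityExists → NontrivialMildAncientTypeIExists

/-- **Albritton–Barker 2019, Theorem 1.1 from its printed tools**: the corrected rendering
`AlbrittonBarkerTypeICharacterization` follows from the forward half (`AlbrittonBarkerForward`,
Seregin–Šverák's blow-up procedure), Lemma 2.2 (`SuitableCompactness`) and Prop. 2.3
(`PersistenceOfSingularities`), the reverse half being proved in `LocalTypeIReverse.lean`.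
[cite: AlbrittonBarker2019, Thm 1.1] -/
theorem albrittonBarkerTypeICharacterization_of_tools (hfwd : AlbrittonBarkerForward)
    (h22 : SuitableCompactness) (h23 : PersistenceOfSingularities) :
    AlbrittonBarkerTypeICharacterization :=
  ⟨hfwd, localTypeISingularityExists_of_nontrivialMildAncientTypeIExists h22 h23⟩

end Literature.Analysis.FluidPDE
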